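import Literature.MathematicalPhysics.QuantumFieldTheory.Balaban1983to89.B8Eq1117ConcreteAnalytic
import Literature.Analysis.Complex.GateauxHolomorphicBall
import Literature.Analysis.Complex.HolomorphicBanach
import Literature.Analysis.Complex.SeveralVariables

/-!
# `Balaban1983to89.B8Eq1117FrechetAnalytic` — T. Bałaban, *Spaces of regular gauge field configurations on a lattice and gauge fixing
# conditions*, Commun. Math. Phys. **99** (1985) 75–102 [Balaban1985RegularSpaces], Sect. E p. 97: «This solution is an analytic
# function of λ» for the CONCRETE lattice `C′`/`D′` — THE FRÉCHET FORM: analytic along every sitewise-ANALYTIC family of `λ`'s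
# parametrized by an open subset of ANY complex normed space (file 4 of the series `B8CprimeCurveAnalytic` →
# `B8Eq1118PicardAnalytic` → `B8Eq1117ConcreteAnalytic`)

statement-level skeleton of published theorems with citation tags; proofs where landed; nothing here is a claim about the Yang–Mills mass gap

PDF held: `paper:balaban1985-cmp99-regular-spaces-gauge-fixing` (journal page = PDF page + 74); p. 97 [PDF 23] (text layer `p0023.txt`
L12–L13, this unit, 2026-08-21): «exists exactly one solution of Eq. (1.117). This solution is an analytic function of λ defined on
the set of λ satisfying (1.119).»; [3] = [Balaban1985Averaging] p. 50 (208): «ũ′ʲ are analytic functions of λ, and Q′_j(u₁,λ) … are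
analytic functions of λ also».

CITATION HEADER (lean-in-tree rule).  Cell `lit-balaban` (HOME `run/shared/lean/pub/lit-balaban/`), unit `lit-balaban-p05` (Phase-2 proof
seat p05, gen 6; TAKING line HOME/STATUS.md 2026-08-21T09:39:21Z; free-target protocol G.5-34(d); owner of block B8 = `lit-balaban-r05`,
referee ref-4).  Rows served: **`B8.Eq1.113`** / **`B8.Claim@97`** — the p. 97 analyticity sentence for the CONCRETE
`C′ = B8Eq1117Concrete.CnlF`, `D′ = B8Eq1113Concrete.Dprime` (`H′` abstract), now in the FRÉCHET form on an arbitrary complex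
normed parameter space; this discharges, for every Banach space of `λ`'s whose site evaluations are continuous linear (e.g. unit
r05's `B8Eq1119LambdaSpace`, norm `max{|λ|, Lᵏ|Dλ|}`), the hypothesis «`C′` analytic» of r05's abstract `B8Eq1117Analytic.Dprime_analyticAt`
and gives the conclusion «`D′` analytic» directly.

WHAT THIS FILE PROVES (kernel, no `sorry`, standard axioms; theorems only).  Let `E` be any complex normed space, `V ⊂ E` open, and
`γ : E → (ℤᵈ → 𝔸)` SITEWISE ANALYTIC on `V` (`t ↦ γ(t)(x)` analytic on `V` for every site `x`; e.g. `γ(t)(x) = ℓₓ(t)` with continuous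
linear `ℓₓ`).
* **`analyticOnNhd_CnlF_comp_param`** — if `γ(V)` lies in the (207)-domain (= (1.120)), then `t ↦ C′(γ(t))` is ANALYTIC on `V` as a
  map `E ⊃ V → XSpace d k 𝔸` ([3] (208) «analytic functions of λ», Banach-valued and Fréchet): it is G-holomorphic (along every complex
  line `z ↦ a + z•v` the family is a holomorphic curve, file 1 `B8CprimeCurveAnalytic.differentiableOn_CnlF_comp`) and bounded by
  `C′₂(α₃ + α₄)α₄` ((1.121)), hence Fréchet-holomorphic by the GRAVES–TAYLOR–HILLE–ZORN theorem (tree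
  `Literature.Analysis.Complex.GateauxHolomorphic.differentiableOn_of_gateaux_of_locallyBounded`, [Chae1985] Thm 14.9) and analytic by
  [Chae1985] Thm 14.13 (tree `Literature.Analysis.Complex.HolomorphicBanach.analyticOnNhd_of_differentiableOn`).
* **`analyticOnNhd_Dprime_comp_param`** — if `γ(V)` lies in the set (1.119), then `t ↦ D′(γ(t))` is ANALYTIC on `V` (`XSpace`-valued,
  Fréchet): G-holomorphic by file 3 `B8Eq1117ConcreteAnalytic.differentiableOn_Dprime_comp` along the lines, bounded by `α₄/(2B′₀)`
  (`Dprime_spec`), then the same two theorems.  **This is p. 97 «This solution is an analytic function of λ defined on the set of λ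
  satisfying (1.119)» for the concrete lattice `D′`, in full strength.**
* `analyticOnNhd_CnlF_clm` / `analyticOnNhd_Dprime_clm` — the case `γ(t)(x) = ℓ x t` of a family of continuous linear maps
  `ℓ x : E →L[ℂ] 𝔸` (the coordinate maps of a normed space of `λ`'s): `t ↦ C′(ℓ·t)`, `t ↦ D′(ℓ·t)` are analytic on the open sets where
  `ℓ·t` lies in (1.120), resp. (1.119).
READINGS: as in files 1–3 (`𝔤ᶜ`-values; one-level (207)-domain; `H′` abstract with the (1.92)/(1.120)-type modulus bounds; `C′₂ := 2·C2p d`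
in the smallness, GAPS G-B8-17; closed ball `‖X‖ ≤ α₄/(2B′₀)`).  NOT CLAIMED: the lattice `H′` (row B8.Eq1.91 / I-B8-2); the choice of
a particular Banach space of `λ`'s (unit r05).
REUSED BY NAME: `B8CprimeCurveAnalytic.differentiableOn_CnlF_comp`, `B8Eq1117ConcreteAnalytic.differentiableOn_Dprime_comp`,
`B8Eq1117Concrete.CnlF_apply, norm_Cnl_le_of207`, `B8Eq1113Concrete.Dprime_spec`,
`Literature.Analysis.Complex.GateauxHolomorphic.differentiableOn_of_gateaux_of_locallyBounded` ([Chae1985] Thm 14.9, unit p24),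
`Literature.Analysis.Complex.HolomorphicBanach.analyticOnNhd_of_differentiableOn` ([Chae1985] Thm 14.13, unit p24),
`Literature.Analysis.Complex.SCV.isOpen_slice` (the parameter set of a complex line in an open set is open).
Unit `lit-balaban-p05` (gen 6), 2026-08-21.  Nothing here is new mathematics.

[cite: Balaban1985RegularSpaces, p.97 («This solution is an analytic function of λ defined on the set of λ satisfying (1.119)»),
(1.119)–(1.121) p.96; Balaban1985Averaging, (208) p.50; Chae1985, Thm 14.9, Thm 14.13]
-/

noncomputable section

open NormedSpace Finset Metric Set Filter
open scoped BoundedContinuousFunction Topology NNReal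

namespace Literature.MathematicalPhysics.QuantumFieldTheory.Balaban1983to89.B8Eq1117FrechetAnalytic

open B7Prop1Explicit B7Prop2Explicit MatrixLog B7Eq167Flat B7Prop9Flat B7Prop10General
open B7Prop10Flat (one_le_C5 C4'_nonneg C5'_nonneg)
open B7Eq214General (Cgen)
open B7Eq170Flat (cj)
open B8Eq1123Concrete (Cnl)
open B8Ineq125Concrete (C2p C2p_nonneg)
open B8Eq1117Concrete (XSpace CnlF CnlF_apply fpMap norm_Cnl_le_of207)
open B8Eq1113Concrete (Dprime Dprime_spec)
open B8CprimeCurveAnalytic (differentiableOn_CnlF_comp)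
open B8Eq1117ConcreteAnalytic (differentiableOn_Dprime_comp)
open Literature.Analysis.Complex (GateauxHolomorphic.differentiableOn_of_gateaux_of_locallyBounded
  HolomorphicBanach.analyticOnNhd_of_differentiableOn SCV.isOpen_slice)

-- `Site` alone would resolve to the torus sites of `Setup.lean`; re-export the `ℤ^d` sites of `B7Prop1Explicit`.
export B7Prop1Explicit (Site)

variable {d : ℕ}

section Frechet

variable {𝔸 : Type*} [NormedRing 𝔸] [NormOneClass 𝔸] [NormedAlgebra ℂ 𝔸] [CompleteSpace 𝔸]
variable {E : Type*} [NormedAddCommGroup E] [NormedSpace ℂ E]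

omit [NormOneClass 𝔸] [CompleteSpace 𝔸] in
/-- Restricting a sitewise-analytic family to a complex line gives a sitewise-holomorphic curve on the (open) set of parameters of
the line inside `V`. [cite: Chae1985, 14.6 (G-holomorphy along the lines a + zx)] (plumbing; our proof) -/
theorem differentiableOn_line_of_analyticOnNhd {γ : E → Site d → 𝔸} {V : Set E}
    (hγ : ∀ x, AnalyticOnNhd ℂ (fun t => γ t x) V) (a v : E) (x : Site d) :
    DifferentiableOn ℂ (fun z : ℂ => γ (a + z • v) x) {z : ℂ | a + z • v ∈ V} := by
  intro z hz
  have haff : AnalyticAt ℂ (fun z : ℂ => a + z • v) z := analyticAt_const.fun_add (analyticAt_id.fun_smul analyticAt_const)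
  have h := AnalyticAt.comp_of_eq (hγ x (a + z • v) hz) haff rfl
  exact h.differentiableAt.differentiableWithinAt

/-- **[3] (208) «Q′_j(u₁,λ) … are analytic functions of λ» for the remainder `C′ = Q′(u₁,·) − Q′`, BANACH-VALUED AND FRÉCHET**: for a
sitewise-analytic family `γ` on an open subset `V` of any complex normed space `E` with values in the (207)-domain (`‖R(U₀(b))γ(t)(b₊) −
γ(t)(b₋)‖ < α₄η`, `‖γ(t)(x)‖ < α₄`, `η = L⁻ᵏ`), the map `t ↦ C′(γ(t)) ∈ XSpace d k 𝔸` is analytic on `V` — G-holomorphic by file 1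
(`differentiableOn_CnlF_comp` on every complex line) and bounded by (1.121), hence holomorphic by Graves–Taylor–Hille–Zorn and analytic by
[Chae1985] Thm 14.13.  Data and smallness as in `B8Eq1117Concrete.norm_Cnl_le_of207`.
[cite: Balaban1985Averaging, (208), (214) p.50; Balaban1985RegularSpaces, (1.120)–(1.121) p.96, p.97; Chae1985, Thm 14.9, Thm 14.13] -/
theorem analyticOnNhd_CnlF_comp_param {L : ℕ} (hL : 2 ≤ L) {G : Subgroup 𝔸ˣ} (hG : AvgClosed d L G) {U₀ : Site d → Fin d → 𝔸ˣ}
    (hU : ∀ x κ, U₀ x κ ∈ G) {k : ℕ} {γ : E → Site d → 𝔸} {V : Set E} (hV : IsOpen V)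
    (hγ : ∀ x, AnalyticOnNhd ℂ (fun t => γ t x) V)
    {u₁ : Site d → 𝔸ˣ} {α₀ α₃ α₄ : ℝ}
    (hα : 0 < α₀) (hα3 : C0 d * α₀ ≤ 1 / 3) (hα2 : 2 * α₀ ≤ c2' d L)
    (h52 : pdev U₀ < α₀ * (((L : ℝ) ^ k)⁻¹) ^ 2)
    (h207a : ∀ t ∈ V, ∀ (x : Site d) (κ : Fin d), ‖cj (U₀ x κ) (γ t (x + e κ)) - γ t x‖ < α₄ * ((L : ℝ) ^ k)⁻¹)
    (h207b : ∀ t ∈ V, ∀ x : Site d, ‖γ t x‖ < α₄)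
    (hu₁ : InLambda L U₀ u₁ k α₃ (((L : ℝ) ^ k)⁻¹))
    (hα₃ : 0 ≤ α₃) (hα₃' : α₃ ≤ 1 / 200)
    (hs₁ : 200 * C6 d * α₄ ≤ 1) (hs₂ : 12000 * ((d : ℝ) + 1) * L * α₄ ≤ 1) (hs₃ : C4G d L * (α₀ + α₃ + 4 * α₄) ≤ 1)
    (hs₄ : 1024 * ((d : ℝ) + 1) * ((d : ℝ) + 4) * L ^ 2 * α₀ ≤ 1) (hs₅ : 32 * ((d : ℝ) + 1) ^ 2 * C6 d * L ^ 2 * α₀ ≤ 1)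
    (hs₆ : 16 * d * C5' d * C6 d * (L : ℝ) ^ 2 * α₀ ≤ 1) (hs₇ : 8 * d * C6 d * L * α₀ ≤ 1) :
    AnalyticOnNhd ℂ (fun t => CnlF L U₀ u₁ k (γ t)) V := by
  -- the uniform bound (1.121) on `V`
  have hbound : ∀ t ∈ V, ‖CnlF L U₀ u₁ k (γ t)‖ ≤ C2p d * (α₃ + α₄) * α₄ := fun t ht => by
    have hpt : ∀ p : Fin (k + 1) × Site d, ‖Cnl L U₀ u₁ p.1 (γ t) p.2‖ ≤ C2p d * (α₃ + α₄) * α₄ := fun p =>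
      norm_Cnl_le_of207 hL hG hU hα hα3 hα2 h52 (h207a t ht) (h207b t ht) hu₁ hα₃ hα₃' hs₁ hs₂ hs₃ hs₄ hs₅ hs₆ hs₇ p.1
        (Nat.le_of_lt_succ p.1.isLt) p.2
    have hα₄ : 0 < α₄ := by linarith [norm_nonneg (γ t 0), h207b t ht 0]
    have h0 : 0 ≤ C2p d * (α₃ + α₄) * α₄ := by have := C2p_nonneg d; positivity
    exact (BoundedContinuousFunction.norm_le h0).2 fun p => by rw [CnlF_apply ⟨_, hpt⟩]; exact hpt p
  -- G-holomorphy along complex lines (file 1) + boundedness ⇒ Fréchet holomorphy (Graves–Taylor–Hille–Zorn)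
  have hd : DifferentiableOn ℂ (fun t => CnlF L U₀ u₁ k (γ t)) V := by
    refine GateauxHolomorphic.differentiableOn_of_gateaux_of_locallyBounded (fun a _ v => ?_) (fun a ha => ?_)
    · exact differentiableOn_CnlF_comp (γ := fun z : ℂ => γ (a + z • v)) hL hG hU (SCV.isOpen_slice hV a v)
        (fun x => differentiableOn_line_of_analyticOnNhd hγ a v x) hα hα3 hα2 h52 (fun z hz => h207a _ hz)
        (fun z hz => h207b _ hz) hu₁ hα₃ hα₃' hs₁ hs₂ hs₃ hs₄ hs₅ hs₆ hs₇
    · obtain ⟨r, hr, hsub⟩ := Metric.isOpen_iff.1 hV a ha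
      exact ⟨r, hr, C2p d * (α₃ + α₄) * α₄, hsub, fun y hy => hbound y (hsub hy)⟩
  exact HolomorphicBanach.analyticOnNhd_of_differentiableOn hd hV

/-- **p. 97 «This solution is an analytic function of λ defined on the set of λ satisfying (1.119)» — CONCRETE `D′`, FRÉCHET FORM.**
For a sitewise-analytic family `γ` on an open subset `V` of any complex normed space `E` with values in the set (1.119)
(`‖R(U₀(b))γ(t)(b₊) − γ(t)(b₋)‖ < ½α₄η`, `‖γ(t)(x)‖ < ½α₄`), the solution `t ↦ D′(γ(t))` of (1.117) (`B8Eq1113Concrete.Dprime`, radius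
`α₄/(2B′₀)`) is ANALYTIC on `V` as a map into `XSpace d k 𝔸`: G-holomorphic along complex lines by file 3
(`B8Eq1117ConcreteAnalytic.differentiableOn_Dprime_comp`), bounded by `α₄/(2B′₀)` (`Dprime_spec`), hence holomorphic
(Graves–Taylor–Hille–Zorn) and analytic ([Chae1985] Thm 14.13).  Hypotheses = those of `B8Eq1117Concrete.eq1117_existsUnique` along the
family, plus `0 < α₄`.
[cite: Balaban1985RegularSpaces, p.97 («This solution is an analytic function of λ defined on the set of λ satisfying (1.119)»), (1.117)–(1.119) p.96; Chae1985, Thm 14.9, Thm 14.13] -/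
theorem analyticOnNhd_Dprime_comp_param {L : ℕ} (hL : 2 ≤ L) {G : Subgroup 𝔸ˣ} (hG : AvgClosed d L G) {U₀ : Site d → Fin d → 𝔸ˣ}
    (hU : ∀ x κ, U₀ x κ ∈ G) {k : ℕ} (H' : XSpace d k 𝔸 →ₗ[ℂ] (Site d → 𝔸))
    {u₁ : Site d → 𝔸ˣ} {α₀ α₃ α₄ B₀' : ℝ}
    (hα : 0 < α₀) (hα3 : C0 d * α₀ ≤ 1 / 3) (hα2 : 2 * α₀ ≤ c2' d L)
    (h52 : pdev U₀ < α₀ * (((L : ℝ) ^ k)⁻¹) ^ 2)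
    (hB : 0 < B₀')
    (hH0 : ∀ (X : XSpace d k 𝔸) (x : Site d), ‖H' X x‖ ≤ B₀' * ‖X‖)
    (hH1 : ∀ (X : XSpace d k 𝔸) (x : Site d) (κ : Fin d),
      ‖cj (U₀ x κ) (H' X (x + e κ)) - H' X x‖ ≤ B₀' * ‖X‖ * ((L : ℝ) ^ k)⁻¹)
    {γ : E → Site d → 𝔸} {V : Set E} (hV : IsOpen V) (hγ : ∀ x, AnalyticOnNhd ℂ (fun t => γ t x) V)
    (h119a : ∀ t ∈ V, ∀ (x : Site d) (κ : Fin d), ‖cj (U₀ x κ) (γ t (x + e κ)) - γ t x‖ < α₄ / 2 * ((L : ℝ) ^ k)⁻¹)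
    (h119b : ∀ t ∈ V, ∀ x : Site d, ‖γ t x‖ < α₄ / 2)
    (hu₁ : InLambda L U₀ u₁ k α₃ (((L : ℝ) ^ k)⁻¹))
    (hα₃ : 0 ≤ α₃) (hα₃' : α₃ ≤ 1 / 200) (hα₄ : 0 < α₄)
    (hs₁ : 200 * C6 d * (2 * α₄) ≤ 1) (hs₂ : 12000 * ((d : ℝ) + 1) * L * (2 * α₄) ≤ 1)
    (hs₃ : C4G d L * (α₀ + α₃ + 4 * (2 * α₄)) ≤ 1)
    (hs₄ : 1024 * ((d : ℝ) + 1) * ((d : ℝ) + 4) * L ^ 2 * α₀ ≤ 1) (hs₅ : 32 * ((d : ℝ) + 1) ^ 2 * C6 d * L ^ 2 * α₀ ≤ 1)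
    (hs₆ : 16 * d * C5' d * C6 d * (L : ℝ) ^ 2 * α₀ ≤ 1) (hs₇ : 8 * d * C6 d * L * α₀ ≤ 1)
    (hsm : α₃ + α₄ ≤ 1 / (4 * B₀' * (2 * C2p d))) :
    AnalyticOnNhd ℂ (fun t => Dprime L U₀ u₁ k H' (α₄ / (2 * B₀')) (γ t)) V := by
  have hρ : ∀ t ∈ V, ‖Dprime L U₀ u₁ k H' (α₄ / (2 * B₀')) (γ t)‖ ≤ α₄ / (2 * B₀') := fun t ht =>
    (Dprime_spec hL hG hU H' (γ t) hα hα3 hα2 h52 hB hH0 hH1 (h119a t ht) (h119b t ht) hu₁ hα₃ hα₃' hs₁ hs₂ hs₃ hs₄ hs₅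
      hs₆ hs₇ hsm).1.1
  have hd : DifferentiableOn ℂ (fun t => Dprime L U₀ u₁ k H' (α₄ / (2 * B₀')) (γ t)) V := by
    refine GateauxHolomorphic.differentiableOn_of_gateaux_of_locallyBounded (fun a _ v => ?_) (fun a ha => ?_)
    · exact differentiableOn_Dprime_comp (γ := fun z : ℂ => γ (a + z • v)) hL hG hU H' hα hα3 hα2 h52 hB hH0 hH1
        (SCV.isOpen_slice hV a v) (fun x => differentiableOn_line_of_analyticOnNhd hγ a v x) (fun z hz => h119a _ hz)
        (fun z hz => h119b _ hz) hu₁ hα₃ hα₃' hα₄ hs₁ hs₂ hs₃ hs₄ hs₅ hs₆ hs₇ hsm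
    · obtain ⟨r, hr, hsub⟩ := Metric.isOpen_iff.1 hV a ha
      exact ⟨r, hr, α₄ / (2 * B₀'), hsub, fun y hy => hρ y (hsub hy)⟩
  exact HolomorphicBanach.analyticOnNhd_of_differentiableOn hd hV

/-- **The coordinate-map case**: if the family is `γ(t)(x) = ℓ x t` for continuous linear maps `ℓ x : E →L[ℂ] 𝔸` (the site
evaluations of a normed space of `λ`'s — e.g. norm `max{|λ|, Lᵏ|Dλ|}`, in which (1.120) and (1.119) are open balls), then
`t ↦ C′(ℓ·t)` is analytic on every open `V` on which `ℓ·t` lies in the (207)-domain (1.120).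
[cite: Balaban1985Averaging, (208) p.50; Balaban1985RegularSpaces, (1.120)–(1.121) p.96; Chae1985, Thm 14.9, Thm 14.13] -/
theorem analyticOnNhd_CnlF_clm {L : ℕ} (hL : 2 ≤ L) {G : Subgroup 𝔸ˣ} (hG : AvgClosed d L G) {U₀ : Site d → Fin d → 𝔸ˣ}
    (hU : ∀ x κ, U₀ x κ ∈ G) {k : ℕ} (ℓ : Site d → E →L[ℂ] 𝔸) {V : Set E} (hV : IsOpen V)
    {u₁ : Site d → 𝔸ˣ} {α₀ α₃ α₄ : ℝ}
    (hα : 0 < α₀) (hα3 : C0 d * α₀ ≤ 1 / 3) (hα2 : 2 * α₀ ≤ c2' d L)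
    (h52 : pdev U₀ < α₀ * (((L : ℝ) ^ k)⁻¹) ^ 2)
    (h207a : ∀ t ∈ V, ∀ (x : Site d) (κ : Fin d), ‖cj (U₀ x κ) (ℓ (x + e κ) t) - ℓ x t‖ < α₄ * ((L : ℝ) ^ k)⁻¹)
    (h207b : ∀ t ∈ V, ∀ x : Site d, ‖ℓ x t‖ < α₄)
    (hu₁ : InLambda L U₀ u₁ k α₃ (((L : ℝ) ^ k)⁻¹))
    (hα₃ : 0 ≤ α₃) (hα₃' : α₃ ≤ 1 / 200)
    (hs₁ : 200 * C6 d * α₄ ≤ 1) (hs₂ : 12000 * ((d : ℝ) + 1) * L * α₄ ≤ 1) (hs₃ : C4G d L * (α₀ + α₃ + 4 * α₄) ≤ 1)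
    (hs₄ : 1024 * ((d : ℝ) + 1) * ((d : ℝ) + 4) * L ^ 2 * α₀ ≤ 1) (hs₅ : 32 * ((d : ℝ) + 1) ^ 2 * C6 d * L ^ 2 * α₀ ≤ 1)
    (hs₆ : 16 * d * C5' d * C6 d * (L : ℝ) ^ 2 * α₀ ≤ 1) (hs₇ : 8 * d * C6 d * L * α₀ ≤ 1) :
    AnalyticOnNhd ℂ (fun t => CnlF L U₀ u₁ k (fun x => ℓ x t)) V :=
  analyticOnNhd_CnlF_comp_param (γ := fun t x => ℓ x t) hL hG hU hV (fun x t _ => (ℓ x).analyticAt t) hα hα3 hα2 h52 h207a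
    h207b hu₁ hα₃ hα₃' hs₁ hs₂ hs₃ hs₄ hs₅ hs₆ hs₇

/-- **The coordinate-map case for `D′`** — p. 97 «This solution is an analytic function of λ defined on the set of λ satisfying
(1.119)» read on a normed space of `λ`'s with continuous linear site evaluations `ℓ x`: `t ↦ D′(ℓ·t)` is analytic on every open `V` on
which `ℓ·t` lies in (1.119) (for the norm `max{|λ|, Lᵏ|Dλ|}` the whole set (1.119) is such a `V`).
[cite: Balaban1985RegularSpaces, p.97 («This solution is an analytic function of λ defined on the set of λ satisfying (1.119)»); Chae1985, Thm 14.9, Thm 14.13] -/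
theorem analyticOnNhd_Dprime_clm {L : ℕ} (hL : 2 ≤ L) {G : Subgroup 𝔸ˣ} (hG : AvgClosed d L G) {U₀ : Site d → Fin d → 𝔸ˣ}
    (hU : ∀ x κ, U₀ x κ ∈ G) {k : ℕ} (H' : XSpace d k 𝔸 →ₗ[ℂ] (Site d → 𝔸))
    {u₁ : Site d → 𝔸ˣ} {α₀ α₃ α₄ B₀' : ℝ}
    (hα : 0 < α₀) (hα3 : C0 d * α₀ ≤ 1 / 3) (hα2 : 2 * α₀ ≤ c2' d L)
    (h52 : pdev U₀ < α₀ * (((L : ℝ) ^ k)⁻¹) ^ 2)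
    (hB : 0 < B₀')
    (hH0 : ∀ (X : XSpace d k 𝔸) (x : Site d), ‖H' X x‖ ≤ B₀' * ‖X‖)
    (hH1 : ∀ (X : XSpace d k 𝔸) (x : Site d) (κ : Fin d),
      ‖cj (U₀ x κ) (H' X (x + e κ)) - H' X x‖ ≤ B₀' * ‖X‖ * ((L : ℝ) ^ k)⁻¹)
    (ℓ : Site d → E →L[ℂ] 𝔸) {V : Set E} (hV : IsOpen V)
    (h119a : ∀ t ∈ V, ∀ (x : Site d) (κ : Fin d), ‖cj (U₀ x κ) (ℓ (x + e κ) t) - ℓ x t‖ < α₄ / 2 * ((L : ℝ) ^ k)⁻¹)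
    (h119b : ∀ t ∈ V, ∀ x : Site d, ‖ℓ x t‖ < α₄ / 2)
    (hu₁ : InLambda L U₀ u₁ k α₃ (((L : ℝ) ^ k)⁻¹))
    (hα₃ : 0 ≤ α₃) (hα₃' : α₃ ≤ 1 / 200) (hα₄ : 0 < α₄)
    (hs₁ : 200 * C6 d * (2 * α₄) ≤ 1) (hs₂ : 12000 * ((d : ℝ) + 1) * L * (2 * α₄) ≤ 1)
    (hs₃ : C4G d L * (α₀ + α₃ + 4 * (2 * α₄)) ≤ 1)
    (hs₄ : 1024 * ((d : ℝ) + 1) * ((d : ℝ) + 4) * L ^ 2 * α₀ ≤ 1) (hs₅ : 32 * ((d : ℝ) + 1) ^ 2 * C6 d * L ^ 2 * α₀ ≤ 1)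
    (hs₆ : 16 * d * C5' d * C6 d * (L : ℝ) ^ 2 * α₀ ≤ 1) (hs₇ : 8 * d * C6 d * L * α₀ ≤ 1)
    (hsm : α₃ + α₄ ≤ 1 / (4 * B₀' * (2 * C2p d))) :
    AnalyticOnNhd ℂ (fun t => Dprime L U₀ u₁ k H' (α₄ / (2 * B₀')) (fun x => ℓ x t)) V :=
  analyticOnNhd_Dprime_comp_param (γ := fun t x => ℓ x t) hL hG hU H' hα hα3 hα2 h52 hB hH0 hH1 hV
    (fun x t _ => (ℓ x).analyticAt t) h119a h119b hu₁ hα₃ hα₃' hα₄ hs₁ hs₂ hs₃ hs₄ hs₅ hs₆ hs₇ hsm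

end Frechet

end Literature.MathematicalPhysics.QuantumFieldTheory.Balaban1983to89.B8Eq1117FrechetAnalytic

end
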